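import Mathlib
import HarnessLib
import Literature.MathematicalPhysics.QuantumFieldTheory.ConstructiveQFTWave0
import Literature.MathematicalPhysics.QuantumLattice.GaugeGroups
import Literature.MathematicalPhysics.QuantumLattice.GaugeGroupsProofs
import Literature.LinearAlgebra.Matrix.UnitaryGramSchmidtRetraction
import Summits.Ventures.LatticeQCDFlow.Scaling.SparsePatchSectors
import Summits.Ventures.LatticeQCDFlow.Scaling.SparsePatchSectorsLattice
import Summits.Ventures.LatticeQCDFlow.Scaling.SparsePatchSectorsLatticeGroups
import Summits.Ventures.LatticeQCDFlow.Scaling.ExposedPatchSectors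
import Summits.Ventures.LatticeQCDFlow.Scaling.ExposedPatchSectorsLattice

/-!
# LatticeQCDFlow / Scaling — the GAUGE-FIXED PEELABLE-PATCH tunnelling law, abstract part: the reduction of C7(b′) to a finite peel certificate (v3.3, item 86a)

HONEST FRAMING: exact (Metropolis-corrected) sampling algorithms for lattice gauge theory; figures
of merit are autocorrelation/cost numbers at stated couplings and volumes; no continuum-physics
claim.

THEORY-2.md §3.3 / conjecture C7(b′), THIRD STEP.  `Scaling/ExposedPatchSectors*.lean` proved the patch
law for EXPOSED update sets.  For a SOLID BLOCK (all links inside an `l^d` box, `l ≥ 3`) interior links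
are unexposed and the two configurations of an exact block update need NOT be linkwise close: the
kernel may gauge-transform the interior.  What the argument really needs is weaker:

* PEELING replaces exposure.  Suppose every slot is read off by its plaquette UP TO the displacement of
  the other slots (`hlip`: `dist (U_e, V_e) ≤ a_p(U) + a_p(V) + Σ_{other slots} dist (U_{e'}, V_{e'})`).
  If the update set can be PEELED — ranked so that every link has a plaquette whose other updated slots
  have smaller rank, with budgets `w(e) ≥ 2 + Σ_{those slots} w` — then two admissible configurations
  agreeing off the set are `w(e)·c`-close linkwise (`dist_le_of_peelable`) and the exposed argument runs
  with threshold `W·c ≤ ρ` (`mem_connectedComponentIn_of_peelablePatch`).  Exposed sets are `w ≡ 2`.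
* GAUGE FIXING is free.  If before peeling one may replace the updated configuration `V` by a `V'` with
  the same defects, in the same sector, agreeing with `U` off a smaller set `Λ' ⊆ Λ` (`hfix`), only `Λ'`
  needs a certificate (`mem_connectedComponentIn_of_fixablePatch`, `fixablePatch_separates`).
* THE ABSTRACT LAW **`compProd_sector_ne_le_of_fixablePatch`** (+ `_add`): every `μ`-invariant Markov
  kernel moving only `Λ` satisfies `(μ ⊗ₘ κ){sector_ε ≠ sector_ε'} ≤ 2·μ{∃ p touching Λ, a_p ≥ c}`.

The lattice instances (Lipschitz slot detection, gauge invariance of defects and sectors,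
`Lattice/SUN/UN.compProd_sector_ne_le_of_gaugePeelable`) are in the sibling
`Scaling/GaugeFixedPatchSectorsLattice.lean`; the solid-box certificate in `Scaling/BoxPeel.lean`,
`Scaling/BoxPatchSectors.lean`.  No sorry, no new axioms, no `def`.
-/

noncomputable section

open scoped Matrix.Norms.Frobenius ENNReal ProbabilityTheory
open MeasureTheory ProbabilityTheory Metric Set
open Literature.MathematicalPhysics.QuantumFieldTheory

/-! ## §1. Abstract peelable / gauge-fixable patches -/

namespace Summit.Ventures.LatticeQCDFlow.Theory2.Tunnelling

section Peel

variable {E Y ι S : Type*} [PseudoMetricSpace Y] [Fintype S] [DecidableEq S]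

/-- **Peeling gives linkwise closeness.**  If every slot is read off by its plaquette up to the
displacement of the other slots (`hdetL`), and `Λ` carries a peel certificate — every `e ∈ Λ` is a slot
of a plaquette whose other slots in `Λ` have smaller rank, with budget `w e ≥ 2 + Σ_{other slots in Λ} w`
— then two configurations agreeing off `Λ` whose plaquettes touching `Λ` have defect `< c` are
`w(e)·c`-close at every `e ∈ Λ`. [folklore] -/
theorem dist_le_of_peelable {a : ι → (E → Y) → ℝ} {slot : ι → S → E}
    (hdetL : ∀ p s (U V : E → Y), dist (U (slot p s)) (V (slot p s)) ≤
      a p U + a p V + ∑ s' ∈ Finset.univ.erase s, dist (U (slot p s')) (V (slot p s')))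
    {Λ : Set E} {rk : E → ℕ} {w : E → ℝ}
    (hpeel : ∀ e ∈ Λ, ∃ p s, slot p s = e ∧ (∀ s', s' ≠ s → slot p s' ∈ Λ → rk (slot p s') < rk e) ∧
      2 + ∑ s' ∈ Finset.univ.erase s, Λ.indicator w (slot p s') ≤ w e)
    {c : ℝ} (hc : 0 ≤ c) {U V : E → Y} (hUV : ∀ e ∉ Λ, U e = V e)
    (hU : ∀ p s, slot p s ∈ Λ → a p U < c) (hV : ∀ p s, slot p s ∈ Λ → a p V < c) :
    ∀ e ∈ Λ, dist (U e) (V e) ≤ w e * c := by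
  suffices h : ∀ n, ∀ e ∈ Λ, rk e < n → dist (U e) (V e) ≤ w e * c from
    fun e he => h (rk e + 1) e he (Nat.lt_succ_self _)
  intro n
  induction n with
  | zero => exact fun e _ h => absurd h (Nat.not_lt_zero _)
  | succ n ih =>
    intro e he hlt
    obtain ⟨p, s, hps, hrk, hw⟩ := hpeel e he
    have hs : slot p s ∈ Λ := by rw [hps]; exact he
    have hsum : ∑ s' ∈ Finset.univ.erase s, dist (U (slot p s')) (V (slot p s')) ≤
        ∑ s' ∈ Finset.univ.erase s, Λ.indicator w (slot p s') * c := by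
      refine Finset.sum_le_sum fun s' hs' => ?_
      have hne : s' ≠ s := Finset.ne_of_mem_erase hs'
      by_cases hin : slot p s' ∈ Λ
      · rw [Set.indicator_of_mem hin]
        have hlt' : rk (slot p s') < n := by
          have := hrk s' hne hin
          omega
        exact ih _ hin hlt'
      · rw [Set.indicator_of_notMem hin, zero_mul, hUV _ hin, dist_self]
    have h1 := hdetL p s U V
    rw [hps] at h1
    have h2 := hU p s hs
    have h3 := hV p s hs
    have h4 : ∑ s' ∈ Finset.univ.erase s, Λ.indicator w (slot p s') * c =
        (∑ s' ∈ Finset.univ.erase s, Λ.indicator w (slot p s')) * c := by rw [Finset.sum_mul]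
    calc dist (U e) (V e)
        ≤ a p U + a p V + ∑ s' ∈ Finset.univ.erase s, dist (U (slot p s')) (V (slot p s')) := h1
      _ ≤ c + c + (∑ s' ∈ Finset.univ.erase s, Λ.indicator w (slot p s')) * c := by
          rw [← h4]; linarith
      _ = (2 + ∑ s' ∈ Finset.univ.erase s, Λ.indicator w (slot p s')) * c := by ring
      _ ≤ w e * c := mul_le_mul_of_nonneg_right hw hc

/-- **Key lemma (peelable patches stay in the sector).**  As `mem_connectedComponentIn_of_exposedPatch`,
with exposure replaced by a peel certificate of total budget `≤ W` and the threshold `W·c ≤ ρ`. [folklore] -/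
theorem mem_connectedComponentIn_of_peelablePatch {a : ι → (E → Y) → ℝ} {slot : ι → S → E}
    (hlip : ∀ p (U V : E → Y), a p V ≤ a p U + ∑ s, dist (U (slot p s)) (V (slot p s)))
    (hdetL : ∀ p s (U V : E → Y), dist (U (slot p s)) (V (slot p s)) ≤
      a p U + a p V + ∑ s' ∈ Finset.univ.erase s, dist (U (slot p s')) (V (slot p s')))
    {Λ : Set E} {rk : E → ℕ} {w : E → ℝ}
    (hpeel : ∀ e ∈ Λ, ∃ p s, slot p s = e ∧ (∀ s', s' ≠ s → slot p s' ∈ Λ → rk (slot p s') < rk e) ∧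
      2 + ∑ s' ∈ Finset.univ.erase s, Λ.indicator w (slot p s') ≤ w e)
    {W : ℝ} (hW : ∀ e ∈ Λ, w e ≤ W)
    {ρ r : ℝ} (hr : 0 ≤ r)
    (hpath : ∀ y y' : Y, dist y y' ≤ ρ → ∃ γ : ℝ → Y, ContinuousOn γ (Icc (0 : ℝ) 1) ∧ γ 0 = y ∧
      γ 1 = y' ∧ ∀ t ∈ Icc (0 : ℝ) 1, dist (γ t) y ≤ r)
    {c ε : ℝ} (hc : 0 ≤ c) (hcρ : W * c ≤ ρ) (hcr : c + Fintype.card S * r ≤ ε)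
    {U V : E → Y} (hUV : ∀ e ∉ Λ, U e = V e)
    (hU : ∀ p s, slot p s ∈ Λ → a p U < c) (hV : ∀ p s, slot p s ∈ Λ → a p V < c)
    (hUadm : ∀ p, a p U < ε) :
    V ∈ connectedComponentIn {W | ∀ p, a p W < ε} U := by
  classical
  -- the updated links move by at most `ρ`
  have hclose := dist_le_of_peelable hdetL hpeel hc hUV hU hV
  have hsmall : ∀ e ∈ Λ, dist (U e) (V e) ≤ ρ := fun e he =>
    ((hclose e he).trans (mul_le_mul_of_nonneg_right (hW e he) hc)).trans hcρ
  -- linkwise paths: the local path on updated links, the constant path elsewhere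
  have hex : ∀ e, ∃ γ : ℝ → Y, ContinuousOn γ (Icc (0 : ℝ) 1) ∧ γ 0 = U e ∧ γ 1 = V e ∧
      (∀ t ∈ Icc (0 : ℝ) 1, dist (γ t) (U e) ≤ r) ∧ (e ∉ Λ → ∀ t, γ t = U e) := by
    intro e
    by_cases he : e ∈ Λ
    · obtain ⟨γ, hγc, hγ0, hγ1, hγd⟩ := hpath (U e) (V e) (hsmall e he)
      exact ⟨γ, hγc, hγ0, hγ1, hγd, fun h => absurd he h⟩
    · exact ⟨fun _ => U e, continuousOn_const, rfl, hUV e he,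
        fun t _ => by rw [dist_self]; exact hr, fun _ _ => rfl⟩
  choose γ hγc hγ0 hγ1 hγd hγconst using hex
  set W' : ℝ → (E → Y) := fun t e => γ e t with hW'
  have hWc : ContinuousOn W' (Icc (0 : ℝ) 1) := continuousOn_pi.2 fun e => hγc e
  have hW0 : W' 0 = U := funext fun e => hγ0 e
  have hW1 : W' 1 = V := funext fun e => hγ1 e
  have hadm : ∀ t ∈ Icc (0 : ℝ) 1, ∀ p, a p (W' t) < ε := by
    intro t ht p
    have hl := hlip p U (W' t)
    by_cases hp : ∃ s, slot p s ∈ Λ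
    · obtain ⟨s, hs⟩ := hp
      have hsum : ∑ s', dist (U (slot p s')) (W' t (slot p s')) ≤ Fintype.card S * r := by
        calc ∑ s', dist (U (slot p s')) (W' t (slot p s')) ≤ ∑ _s' : S, r :=
              Finset.sum_le_sum fun s' _ => by
                show dist (U (slot p s')) (γ (slot p s') t) ≤ r
                rw [dist_comm]; exact hγd (slot p s') t ht
          _ = Fintype.card S * r := by rw [Finset.sum_const, Finset.card_univ, nsmul_eq_mul]
      have := hU p s hs
      linarith
    · push Not at hp
      have hsum : ∑ s', dist (U (slot p s')) (W' t (slot p s')) = 0 := by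
        refine Finset.sum_eq_zero fun s' _ => ?_
        show dist (U (slot p s')) (γ (slot p s') t) = 0
        rw [hγconst (slot p s') (hp s') t, dist_self]
      have := hUadm p
      linarith
  have hsub : W' '' Icc (0 : ℝ) 1 ⊆ {W | ∀ p, a p W < ε} := by
    rintro _ ⟨t, ht, rfl⟩
    exact hadm t ht
  have h := (isPreconnected_Icc.image W' hWc).subset_connectedComponentIn
    ⟨0, left_mem_Icc.2 zero_le_one, hW0⟩ hsub
  exact h ⟨1, right_mem_Icc.2 zero_le_one, hW1⟩

/-- **Key lemma with gauge fixing.**  If, in addition, every pair `(U, V)` agreeing off `Λ` admits a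
"gauge-fixed" `V'` — agreeing with `U` off the peelable `Λ' ⊆ Λ`, with the same defects as `V`, and in
the sector of `V` whenever `V` is admissible — then `V` lies in the sector of `U`. [folklore] -/
theorem mem_connectedComponentIn_of_fixablePatch {a : ι → (E → Y) → ℝ} {slot : ι → S → E}
    (hlip : ∀ p (U V : E → Y), a p V ≤ a p U + ∑ s, dist (U (slot p s)) (V (slot p s)))
    (hdetL : ∀ p s (U V : E → Y), dist (U (slot p s)) (V (slot p s)) ≤
      a p U + a p V + ∑ s' ∈ Finset.univ.erase s, dist (U (slot p s')) (V (slot p s')))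
    {Λ Λ' : Set E} (hΛ' : Λ' ⊆ Λ) {rk : E → ℕ} {w : E → ℝ}
    (hpeel : ∀ e ∈ Λ', ∃ p s, slot p s = e ∧ (∀ s', s' ≠ s → slot p s' ∈ Λ' → rk (slot p s') < rk e) ∧
      2 + ∑ s' ∈ Finset.univ.erase s, Λ'.indicator w (slot p s') ≤ w e)
    {W : ℝ} (hW : ∀ e ∈ Λ', w e ≤ W)
    {ρ r : ℝ} (hr : 0 ≤ r)
    (hpath : ∀ y y' : Y, dist y y' ≤ ρ → ∃ γ : ℝ → Y, ContinuousOn γ (Icc (0 : ℝ) 1) ∧ γ 0 = y ∧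
      γ 1 = y' ∧ ∀ t ∈ Icc (0 : ℝ) 1, dist (γ t) y ≤ r)
    {c ε : ℝ} (hc : 0 ≤ c) (hcρ : W * c ≤ ρ) (hcr : c + Fintype.card S * r ≤ ε)
    (hfix : ∀ U V : E → Y, (∀ e ∉ Λ, U e = V e) → ∃ V' : E → Y, (∀ e ∉ Λ', U e = V' e) ∧
      (∀ p, a p V' = a p V) ∧
      ((∀ p, a p V < ε) → V' ∈ connectedComponentIn {W | ∀ p, a p W < ε} V))
    {U V : E → Y} (hUV : ∀ e ∉ Λ, U e = V e)
    (hU : ∀ p s, slot p s ∈ Λ → a p U < c) (hV : ∀ p s, slot p s ∈ Λ → a p V < c)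
    (hUadm : ∀ p, a p U < ε) :
    V ∈ connectedComponentIn {W | ∀ p, a p W < ε} U := by
  obtain ⟨V', hUV', haV', hccV'⟩ := hfix U V hUV
  have hU' : ∀ p s, slot p s ∈ Λ' → a p U < c := fun p s hs => hU p s (hΛ' hs)
  have hV' : ∀ p s, slot p s ∈ Λ' → a p V' < c := fun p s hs => by rw [haV']; exact hV p s (hΛ' hs)
  have h1 : V' ∈ connectedComponentIn {W | ∀ p, a p W < ε} U :=
    mem_connectedComponentIn_of_peelablePatch hlip hdetL hpeel hW hr hpath hc hcρ hcr hUV' hU' hV' hUadm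
  have hV'adm : ∀ p, a p V' < ε := connectedComponentIn_subset _ _ h1
  have hVadm : ∀ p, a p V < ε := fun p => by rw [← haV']; exact hV'adm p
  have h3 : connectedComponentIn {W | ∀ p, a p W < ε} V = connectedComponentIn {W | ∀ p, a p W < ε} V' :=
    connectedComponentIn_eq (hccV' hVadm)
  have h4 : connectedComponentIn {W | ∀ p, a p W < ε} U = connectedComponentIn {W | ∀ p, a p W < ε} V' :=
    connectedComponentIn_eq h1
  rw [h4, ← h3]
  exact mem_connectedComponentIn hVadm

/-- **Separating lemma for gauge-fixable peelable patches.** [folklore] -/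
theorem fixablePatch_separates {a : ι → (E → Y) → ℝ} {slot : ι → S → E}
    (hlip : ∀ p (U V : E → Y), a p V ≤ a p U + ∑ s, dist (U (slot p s)) (V (slot p s)))
    (hdetL : ∀ p s (U V : E → Y), dist (U (slot p s)) (V (slot p s)) ≤
      a p U + a p V + ∑ s' ∈ Finset.univ.erase s, dist (U (slot p s')) (V (slot p s')))
    {Λ Λ' : Set E} (hΛ' : Λ' ⊆ Λ) {rk : E → ℕ} {w : E → ℝ}
    (hpeel : ∀ e ∈ Λ', ∃ p s, slot p s = e ∧ (∀ s', s' ≠ s → slot p s' ∈ Λ' → rk (slot p s') < rk e) ∧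
      2 + ∑ s' ∈ Finset.univ.erase s, Λ'.indicator w (slot p s') ≤ w e)
    {W : ℝ} (hW : ∀ e ∈ Λ', w e ≤ W)
    {ρ r : ℝ} (hr : 0 ≤ r)
    (hpath : ∀ y y' : Y, dist y y' ≤ ρ → ∃ γ : ℝ → Y, ContinuousOn γ (Icc (0 : ℝ) 1) ∧ γ 0 = y ∧
      γ 1 = y' ∧ ∀ t ∈ Icc (0 : ℝ) 1, dist (γ t) y ≤ r)
    {c ε : ℝ} (hc : 0 ≤ c) (hcρ : W * c ≤ ρ) (hcr : c + Fintype.card S * r ≤ ε)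
    (hfix : ∀ U V : E → Y, (∀ e ∉ Λ, U e = V e) → ∃ V' : E → Y, (∀ e ∉ Λ', U e = V' e) ∧
      (∀ p, a p V' = a p V) ∧
      ((∀ p, a p V < ε) → V' ∈ connectedComponentIn {W | ∀ p, a p W < ε} V))
    {U V : E → Y} (hUV : ∀ e ∉ Λ, U e = V e)
    (hne : connectedComponentIn {W | ∀ p, a p W < ε} U ≠ connectedComponentIn {W | ∀ p, a p W < ε} V) :
    U ∈ {U : E → Y | ∃ p s, slot p s ∈ Λ ∧ c ≤ a p U} ∨
      V ∈ {U : E → Y | ∃ p s, slot p s ∈ Λ ∧ c ≤ a p U} := by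
  by_contra h
  simp only [mem_setOf_eq, not_or, not_exists, not_and, not_le] at h
  obtain ⟨hU, hV⟩ := h
  by_cases hUadm : ∀ p, a p U < ε
  · exact hne (connectedComponentIn_eq
      (mem_connectedComponentIn_of_fixablePatch hlip hdetL hΛ' hpeel hW hr hpath hc hcρ hcr hfix hUV hU hV
        hUadm))
  · push Not at hUadm
    obtain ⟨p, hp⟩ := hUadm
    have hS : (0 : ℝ) ≤ Fintype.card S * r := mul_nonneg (Nat.cast_nonneg _) hr
    have hc' : c ≤ ε := by linarith
    have hpΛ : ∀ s, slot p s ∉ Λ := fun s hs => absurd (hU p s hs) (not_lt.2 (hc'.trans hp))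
    have hVp : ε ≤ a p V := by
      have hl := hlip p V U
      have hsum : ∑ s, dist (V (slot p s)) (U (slot p s)) = 0 :=
        Finset.sum_eq_zero fun s _ => by rw [hUV _ (hpΛ s), dist_self]
      linarith
    have hUe : connectedComponentIn {W : E → Y | ∀ p, a p W < ε} U = ∅ :=
      connectedComponentIn_eq_empty fun h => (not_lt.2 hp) (h p)
    have hVe : connectedComponentIn {W : E → Y | ∀ p, a p W < ε} V = ∅ :=
      connectedComponentIn_eq_empty fun h => (not_lt.2 hVp) (h p)
    exact hne (hUe.trans hVe.symm)

end Peel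

section Laws

variable {E Y ι S : Type*} [PseudoMetricSpace Y] [Fintype S] [DecidableEq S] [MeasurableSpace (E → Y)]

/-- **Gauge-fixed peelable-patch tunnelling law (one step).**  `(μ ⊗ₘ κ){sector ≠ sector'} ≤
2·μ{∃ p touching Λ, c ≤ a p}` for every s-finite `μ` and every `μ`-invariant Markov kernel moving a.s.
only the links of `Λ`, given a gauge fixing onto a peelable `Λ' ⊆ Λ` of budget `W`; thresholds `0 ≤ c`,
`W·c ≤ ρ`, `c + #S·r ≤ ε`. [folklore] -/
theorem compProd_sector_ne_le_of_fixablePatch {a : ι → (E → Y) → ℝ} {slot : ι → S → E}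
    (hlip : ∀ p (U V : E → Y), a p V ≤ a p U + ∑ s, dist (U (slot p s)) (V (slot p s)))
    (hdetL : ∀ p s (U V : E → Y), dist (U (slot p s)) (V (slot p s)) ≤
      a p U + a p V + ∑ s' ∈ Finset.univ.erase s, dist (U (slot p s')) (V (slot p s')))
    {Λ Λ' : Set E} (hΛ' : Λ' ⊆ Λ) {rk : E → ℕ} {w : E → ℝ}
    (hpeel : ∀ e ∈ Λ', ∃ p s, slot p s = e ∧ (∀ s', s' ≠ s → slot p s' ∈ Λ' → rk (slot p s') < rk e) ∧
      2 + ∑ s' ∈ Finset.univ.erase s, Λ'.indicator w (slot p s') ≤ w e)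
    {W : ℝ} (hW : ∀ e ∈ Λ', w e ≤ W)
    {ρ r : ℝ} (hr : 0 ≤ r)
    (hpath : ∀ y y' : Y, dist y y' ≤ ρ → ∃ γ : ℝ → Y, ContinuousOn γ (Icc (0 : ℝ) 1) ∧ γ 0 = y ∧
      γ 1 = y' ∧ ∀ t ∈ Icc (0 : ℝ) 1, dist (γ t) y ≤ r)
    {c ε : ℝ} (hc : 0 ≤ c) (hcρ : W * c ≤ ρ) (hcr : c + Fintype.card S * r ≤ ε)
    (hfix : ∀ U V : E → Y, (∀ e ∉ Λ, U e = V e) → ∃ V' : E → Y, (∀ e ∉ Λ', U e = V' e) ∧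
      (∀ p, a p V' = a p V) ∧
      ((∀ p, a p V < ε) → V' ∈ connectedComponentIn {W | ∀ p, a p W < ε} V))
    (μ : Measure (E → Y)) [SFinite μ] (κ : Kernel (E → Y) (E → Y)) [IsMarkovKernel κ]
    (hinv : κ.Invariant μ) (hΛ : ∀ᵐ q ∂(μ ⊗ₘ κ), ∀ e ∉ Λ, q.1 e = q.2 e) :
    (μ ⊗ₘ κ) {q | connectedComponentIn {W | ∀ p, a p W < ε} q.1 ≠
        connectedComponentIn {W | ∀ p, a p W < ε} q.2} ≤
      2 * μ {U | ∃ p s, slot p s ∈ Λ ∧ c ≤ a p U} :=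
  compProd_chargeChange_le_of_invariant (R := fun U V : E → Y => ∀ e ∉ Λ, U e = V e)
    (Q := fun U : E → Y => connectedComponentIn {W | ∀ p, a p W < ε} U)
    (B := {U : E → Y | ∃ p s, slot p s ∈ Λ ∧ c ≤ a p U})
    (fun _ _ hUV hne => fixablePatch_separates hlip hdetL hΛ' hpeel hW hr hpath hc hcρ hcr hfix hUV hne)
    μ κ hinv hΛ

/-- **Gauge-fixed peelable-patch law with an exceptional set.** [folklore] -/
theorem compProd_sector_ne_le_of_fixablePatch_add {a : ι → (E → Y) → ℝ} {slot : ι → S → E}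
    (hlip : ∀ p (U V : E → Y), a p V ≤ a p U + ∑ s, dist (U (slot p s)) (V (slot p s)))
    (hdetL : ∀ p s (U V : E → Y), dist (U (slot p s)) (V (slot p s)) ≤
      a p U + a p V + ∑ s' ∈ Finset.univ.erase s, dist (U (slot p s')) (V (slot p s')))
    {Λ Λ' : Set E} (hΛ' : Λ' ⊆ Λ) {rk : E → ℕ} {w : E → ℝ}
    (hpeel : ∀ e ∈ Λ', ∃ p s, slot p s = e ∧ (∀ s', s' ≠ s → slot p s' ∈ Λ' → rk (slot p s') < rk e) ∧
      2 + ∑ s' ∈ Finset.univ.erase s, Λ'.indicator w (slot p s') ≤ w e)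
    {W : ℝ} (hW : ∀ e ∈ Λ', w e ≤ W)
    {ρ r : ℝ} (hr : 0 ≤ r)
    (hpath : ∀ y y' : Y, dist y y' ≤ ρ → ∃ γ : ℝ → Y, ContinuousOn γ (Icc (0 : ℝ) 1) ∧ γ 0 = y ∧
      γ 1 = y' ∧ ∀ t ∈ Icc (0 : ℝ) 1, dist (γ t) y ≤ r)
    {c ε : ℝ} (hc : 0 ≤ c) (hcρ : W * c ≤ ρ) (hcr : c + Fintype.card S * r ≤ ε)
    (hfix : ∀ U V : E → Y, (∀ e ∉ Λ, U e = V e) → ∃ V' : E → Y, (∀ e ∉ Λ', U e = V' e) ∧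
      (∀ p, a p V' = a p V) ∧
      ((∀ p, a p V < ε) → V' ∈ connectedComponentIn {W | ∀ p, a p W < ε} V))
    (μ : Measure (E → Y)) [SFinite μ] (κ : Kernel (E → Y) (E → Y)) [IsMarkovKernel κ]
    (hinv : κ.Invariant μ) :
    (μ ⊗ₘ κ) {q | connectedComponentIn {W | ∀ p, a p W < ε} q.1 ≠
        connectedComponentIn {W | ∀ p, a p W < ε} q.2} ≤
      2 * μ {U | ∃ p s, slot p s ∈ Λ ∧ c ≤ a p U} + (μ ⊗ₘ κ) {q | ¬ ∀ e ∉ Λ, q.1 e = q.2 e} :=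
  compProd_chargeChange_le_add_of_invariant (R := fun U V : E → Y => ∀ e ∉ Λ, U e = V e)
    (Q := fun U : E → Y => connectedComponentIn {W | ∀ p, a p W < ε} U)
    (B := {U : E → Y | ∃ p s, slot p s ∈ Λ ∧ c ≤ a p U})
    (fun _ _ hUV hne => fixablePatch_separates hlip hdetL hΛ' hpeel hW hr hpath hc hcρ hcr hfix hUV hne)
    μ κ hinv

end Laws

end Summit.Ventures.LatticeQCDFlow.Theory2.Tunnelling
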